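import Summits.QuantumFields.GaugeBoot.Certificates.SparseReducedTrace
import Summits.QuantumFields.GaugeBoot.Certificates.N2c2D4EntA
import Summits.QuantumFields.GaugeBoot.Certificates.N2c2D4EntB
import Summits.QuantumFields.GaugeBoot.Certificates.N2c2D4EntC
import Summits.QuantumFields.GaugeBoot.Certificates.N2c2D4EntD
import Summits.QuantumFields.GaugeBoot.Certificates.N2c2D4EntE
import Summits.QuantumFields.GaugeBoot.Certificates.N2c2D4EntF
import Summits.QuantumFields.GaugeBoot.Certificates.N2c2D4EntG
import Summits.QuantumFields.GaugeBoot.Certificates.N2c2D4EntH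
import Summits.QuantumFields.GaugeBoot.Certificates.N2c2D4EntI
import Summits.QuantumFields.GaugeBoot.Certificates.N2c2D4EntJ
import Summits.QuantumFields.GaugeBoot.Certificates.N2c2D4EntK
import HarnessLib

/-!
# Kernel checks of the reduced problem family `N2c2D4`, part A (tables and dimension check) (gb_lean_emit_reduced 0.8.6)

HONEST FRAMING (cell `pub-gaugeboot`): certified bounds on lattice expectations at stated coupling,
gauge group, dimension and torus size; NOT a mass gap, NOT a continuum limit, NOT a string tension;
NOT Yang–Mills-summit-bearing (barriers `FixedCouplingUltralocality`, `PerturbativeInvisibility`).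
Family `N2c2D4` (4480 variables, 34 reduced blocks of dimensions `dimL`, max 42; signature sha256
`1010e59a763bb6c62fc4e2aca203df8058838c2cc9a3fe3a7b51281691620d46`): SWEEP ROUTE (emitter ≥ 0.8.5) — `N2c2D4TabA` assembles the entry tables `EB` and runs the ONE β-independent
kernel check `dimCheck` (entries outside a block's own dimension are empty); there are NO position lists, shape or cover checks:
each certificate module verifies its trace table by the entry sweep of `Certificates/SparseReducedSweepU.lean`; the interface
`dim`/`ent`/`redBlock`/`redBlock_apply` is in `N2c2D4Tab`.

Nothing is claimed about lattice gauge theory in this file.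
-/

namespace Summit.QuantumFields.GaugeBoot.Certificates.N2c2D4

noncomputable section

open Matrix Summit.QuantumFields.GaugeBoot.Certificates.Sparse

/-- The upper-triangular entry tables of all blocks (parts concatenated in block order). -/
def EB : List (List (List (List (ℕ × ℤ)))) := EBa ++ EBb ++ EBc ++ EBd ++ EBe ++ EBf ++ EBg ++ EBh ++ EBi ++ EBj ++ EBk

set_option maxHeartbeats 0 in
/-- Kernel check: entries outside each block's own dimension are empty (padding to 42×42). -/
theorem dim_chk : dimCheck EB dimL 42 34 = true := by
  decide +kernel


end

end Summit.QuantumFields.GaugeBoot.Certificates.N2c2D4
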